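import Summits.QuantumFields.BalabanUV.T4Continuum.Support.NE7TensionPairing
import Summits.QuantumFields.BalabanUV.T4Continuum.Support.NE3CurlPairedResidualMulti
import Summits.QuantumFields.BalabanUV.T4Continuum.Support.MinimalActionRate

/-!
# NE7MinimiserTensionPairing — STEP (E2) OF THE ENERGY ROAD ASSEMBLED: the Yang–Mills tension of an INTERIOR `(j+2)`-level constrained
# minimiser of `sfClass d L N ε` is `a²`-ORTHOGONAL to every skew periodic direction tangent to the fibre of the linearised iterated average
# (the tree's multi-level criticality BY NAME ∘ gen 62's tension pairing)

Cell `pub-balaban`, rung (B)+1 sub-cell t4, lineage `b2b-balaban-t4-ne7-p1`, generation 62 (CRUX PROVER NE7 #1, ruling e34b3e0c (2)); hunt (h7)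
«ENERGY ROAD» (memo v2 `t4/b2b-balaban-t4-ne7-p1-g62/HUNT-H7-ENERGY-ROAD-v2.md`), step (E2).  INPUTS BY NAME: the NE3 swarm's
**`NE3CurlPairedResidualMulti.hasDerivAt_fineAction_vary_multiLevel`** (the `(j+2)`-level constrained minimiser is critical for the fine Wilson
action of the period along every skew periodic `ψ` with `TangentIter L j (cavg L U) (cpush L U ψ)`; Lagrange argument on the finite torus chart) and
gen 62's **`NE7TensionPairing.tension_pairing_le_of_critical`** (criticality along `ψ` ⇒ `|Σ_x Σ_ν hsR (frame U ψ x ν) (T_ν(x))| ≤ 12·#Plane·a²·dirL1 ψ`).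
THIS file does the bookkeeping between Bałaban's minimiser notion of route 1 (`MinimalActionSandwich.IsMinimiser d (sfClass d L N ε) L N (j+2) V U`:
class `sfClass`, constraint `avgIter L U (j+2) = V`, the level action `levelAction = (stepWt⁻¹)^{j+2}·fineAction … (perWin …)`) and the criticality
theorem's (`cavgIter`, `blockWindow L (periodBox (L·tower L N j))`, `SmallField U b` with `b = ε(L^{j+2})^{−2}`):

* §1 `period_eq` (`L·(L·tower L N j) = N·L^{j+2}`), `fineAction_le_of_isMinimiser` (the honest minimality of `IsMinimiser` is the `fineAction`
  minimality of the criticality theorem's `hmin`, via `cavgIter_eq_avgIter`, `blockWindow_periodBox_snd`, `stepWt_pos`);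
* §2 **`critical_of_interior_isMinimiser`**: an `IsMinimiser d (sfClass d L N ε) L N (j+2) V U` lying in `SmallField U a` with `a < ε(L^{j+2})^{−2}`
  (INTERIORITY (8), a hypothesis) and `LevelSmall d L (j+1) (ε(L^{j+2})^{−2})` is critical along every skew `N·L^{j+2}`-periodic tangent `ψ`:
  `HasDerivAt (s ↦ fineAction (vary U ψ s) (plaqsOf (periodBox (N·L^{j+2})))) 0 0`;
* §3 **`tension_pairing_le_of_interior_isMinimiser`**: for such `U`, `ψ` and the flux form `B` of `U` (`0 ≤ a ≤ 1∕4`):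
  `|Σ_{x ∈ periodBox (N·L^{j+2})} Σ_ν hsR (frame U ψ x ν) (Σ_μ ∇_μ^† B_{μν}(x))| ≤ 12·#Plane(d)·a²·dirL1 ψ (periodBox (N·L^{j+2}))` —
  hypothesis (i) of `NE7TensionKernelCoercivity.tension_energy_le_of_kernel_pairing_of_coercive` in lattice form (its `θ`, up to the `ℓ¹∕ℓ²` and
  HS∕operator-norm conversions and the identification of `ker Q` with `TangentIter`).
(`LevelSmall d L (j+1) (ε∕(L^{j+2})²)` for every `j` is the tree's `NE7EtaBackgroundLevelSmallDischarge.levelSmall_hls (j+1)` under `L ≥ 2`, `0 ≤ ε`,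
`16·C₀·ε ≤ 3`, `2·twoLevelSmall·ε ≤ L²` — kept as a hypothesis here to spare that import.)
HONEST FRAMING (page 1): re-assembly of kernel theorems; interiority (8) is ASSUMED (`a < ε(L^{j+2})^{−2}`), not proved; (α), (β) of the memo remain;
NE7, NE3 NOT PRINTED in [Balaban1984PropagatorsI]–[Balaban1989LargeFieldII] and NOT PROVED; FIXED FINITE torus, rung (B)+1; continuum YM on T⁴ ⇐
BetaPertH ∧ nine spine estimates (0/9 proved); BetaPertH ⇐ (D1) ∧ (D4) ∧ CAP+tail; G-an2-4 gates asym, D1 and NE2/3/4; NOT infinite volume, NOT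
mass gap, NOT Clay.  0 def, 0 sorry.
-/

set_option autoImplicit false

open scoped BigOperators Matrix Matrix.Norms.L2Operator Topology
open NormedSpace Finset

namespace Summit.QuantumFields.BalabanUV.T4Continuum.NE7MinimiserTensionPairing

open Literature.MathematicalPhysics.QuantumFieldTheory.Balaban1983to89
open B7Prop1Explicit B7Prop2Explicit MatrixLog UnitaryModel MatrixNorms
open T4AveragingDeficitWall hiding Site Plane Plaq Bond
open T4AveragingDeficitWallBoundary (periodBox IsPeriodicCfg)
open AveragingDeficitPeriodicCounting (IsPeriodicDir)
open AveragingDeficitChartCalculus (cavg)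
open AveragingDeficitMultiLevelPrep (tower cavgIter LevelSmall TangentIter cpush)
open AveragingDeficitMultiLevelBridge (cavgIter_eq_avgIter tower_eq)
open MinimalActionLevels (levelAction perWin stepWt stepWt_pos blockWindow_periodBox_snd)
open MinimalActionSandwich (IsMinimiser admissible)
open MinimalActionRate (sfClass)
open NE3HessShapes (plaqsOf)
open NE3CovariantCalculus (hsR cDstar)
open NE3CovariantWeitzenbock (frame)
open NE3CurlPairedResidualMulti (hasDerivAt_fineAction_vary_multiLevel)
open NE7TensionPairing (tension_pairing_le_of_critical)

noncomputable section

variable {d : ℕ} {n : Type*} [Fintype n] [DecidableEq n]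

/-! ## §1 Bookkeeping between `IsMinimiser` and the criticality theorem's minimality -/

omit [Fintype n] [DecidableEq n] in
/-- The period of level `j+2` in the two presentations: `L·(L·tower L N j) = N·L^{j+2}`. [folklore] -/
theorem period_eq (L N j : ℕ) : L * (L * tower L N j) = N * L ^ (j + 2) := by
  rw [tower_eq]; ring

omit [Fintype n] [DecidableEq n] in
/-- The same as integers: `(L : ℤ)·((L·tower L N j : ℕ) : ℤ) = ((N·L^{j+2} : ℕ) : ℤ)`. [folklore] -/
theorem period_eq_int (L N j : ℕ) : (L : ℤ) * ((L * tower L N j : ℕ) : ℤ) = ((N * L ^ (j + 2) : ℕ) : ℤ) := by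
  rw [← period_eq]; push_cast; ring

/-- The fine window of the criticality theorem is the period window of level `j+2`: `(blockWindow L (periodBox (L·tower L N j))).2 =
plaqsOf (periodBox (N·L^{j+2}))` (`L ≥ 1`). [folklore] -/
theorem blockWindow_snd_eq (L N j : ℕ) (hL : 1 ≤ L) :
    (blockWindow L (periodBox (d := d) (L * tower L N j))).2 = plaqsOf (periodBox (d := d) (N * L ^ (j + 2))) := by
  rw [blockWindow_periodBox_snd L _ hL, period_eq]
  rfl

/-- **THE HONEST MINIMALITY IS THE CRITICALITY THEOREM'S MINIMALITY**: for an `IsMinimiser d (sfClass d L N ε) L N (j+2) V U` (`L ≥ 1`), every unitary `U′`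
of period `L·(L·tower L N j)` in `SmallField U′ (ε∕(L^{j+2})²)` with `cavgIter L (j+2) U′ = cavgIter L (j+2) U` has
`fineAction U (…).2 ≤ fineAction U′ (…).2` on the period window (`U′` is admissible: `cavgIter_eq_avgIter`; `levelAction = (stepWt⁻¹)^{j+2}·fineAction`).
[folklore] -/
theorem fineAction_le_of_isMinimiser [Nonempty n] {L N : ℕ} (hL : 1 ≤ L) {ε : ℝ} (j : ℕ) {V U : Site d → Fin d → (Matrix n n ℂ)ˣ}
    (hmin : IsMinimiser d (sfClass d L N ε) L N (j + 2) V U) :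
    ∀ U' : Site d → Fin d → (Matrix n n ℂ)ˣ, IsUnitaryCfg U' → IsPeriodicCfg U' ((L : ℤ) * (L * tower L N j : ℕ)) →
      SmallField U' (ε / ((L : ℝ) ^ (j + 2)) ^ 2) → cavgIter L (j + 2) U' = cavgIter L (j + 2) U →
        fineAction U (blockWindow L (periodBox (d := d) (L * tower L N j))).2
          ≤ fineAction U' (blockWindow L (periodBox (d := d) (L * tower L N j))).2 := by
  intro U' hU' hU'P hU'a hU'eq
  have hU'P' : IsPeriodicCfg U' ((N * L ^ (j + 2) : ℕ) : ℤ) := by rw [← period_eq_int]; exact hU'P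
  have hadm : U' ∈ admissible (sfClass d L N ε) L (j + 2) V := by
    refine ⟨⟨hU', hU'P', hU'a⟩, ?_⟩
    have h := hmin.mem.2
    rw [← cavgIter_eq_avgIter] at h ⊢
    rw [hU'eq, h]
  have hle := hmin.le U' hadm
  unfold levelAction at hle
  have hw : 0 < ((stepWt d L)⁻¹) ^ (j + 2) := pow_pos (inv_pos.mpr (stepWt_pos (d := d) L hL)) _
  rw [blockWindow_periodBox_snd L _ hL, period_eq]
  exact le_of_mul_le_mul_left hle hw

/-! ## §2 Criticality of an interior constrained minimiser along every tangent direction -/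

/-- **AN INTERIOR `(j+2)`-LEVEL CONSTRAINED MINIMISER IS CRITICAL ALONG EVERY TANGENT DIRECTION** (the tree's
`hasDerivAt_fineAction_vary_multiLevel` BY NAME, in route 1's vocabulary): for `IsMinimiser d (sfClass d L N ε) L N (j+2) V U` (`L, N ≥ 1`) with
`SmallField U a`, `0 ≤ a < ε∕(L^{j+2})²` (INTERIORITY (8), assumed) and `LevelSmall d L (j+1) (ε∕(L^{j+2})²)`, and every skew `N·L^{j+2}`-periodic `ψ`
with `TangentIter L j (cavg L U) (cpush L U ψ)`:  `HasDerivAt (s ↦ fineAction (vary U ψ s) (plaqsOf (periodBox (N·L^{j+2})))) 0 0`. [folklore] -/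
theorem critical_of_interior_isMinimiser [Nonempty n] {L N : ℕ} (hL : 1 ≤ L) (hN : 1 ≤ N) {ε a : ℝ} (j : ℕ)
    {V U : Site d → Fin d → (Matrix n n ℂ)ˣ} (hmin : IsMinimiser d (sfClass d L N ε) L N (j + 2) V U)
    (ha0 : 0 ≤ a) (haε : a < ε / ((L : ℝ) ^ (j + 2)) ^ 2) (hUa : SmallField U a)
    (hls : LevelSmall d L (j + 1) (ε / ((L : ℝ) ^ (j + 2)) ^ 2))
    {ψ : Site d → Fin d → Matrix n n ℂ} (hψs : IsSkewDir ψ) (hψP : IsPeriodicDir ψ ((N * L ^ (j + 2) : ℕ) : ℤ))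
    (hψT : TangentIter L j (cavg L U) (cpush L U ψ)) :
    HasDerivAt (fun s : ℝ => fineAction (vary U ψ s) (plaqsOf (periodBox (d := d) (N * L ^ (j + 2))))) 0 0 := by
  haveI : NeZero L := ⟨by omega⟩
  haveI : NeZero N := ⟨by omega⟩
  have hUP : IsPeriodicCfg U ((L : ℤ) * (L * tower L N j : ℕ)) := by rw [period_eq_int]; exact hmin.mem.1.2.1
  have hψP' : IsPeriodicDir ψ ((L : ℤ) * (L * tower L N j : ℕ)) := by rw [period_eq_int]; exact hψP
  have h := hasDerivAt_fineAction_vary_multiLevel j hmin.mem.1.1 hUP ha0 haε hls hUa (fineAction_le_of_isMinimiser hL j hmin) hψs hψP' hψT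
  rw [blockWindow_snd_eq L N j hL] at h
  exact h

/-! ## §3 The tension of an interior constrained minimiser is `a²`-orthogonal to the tangent directions -/

/-- **STEP (E2) — THE TENSION PAIRING OF AN INTERIOR CONSTRAINED MINIMISER IS `O(a²)·‖ψ‖_{ℓ¹}` ON TANGENT DIRECTIONS.**  For
`IsMinimiser d (sfClass d L N ε) L N (j+2) V U` (`L, N ≥ 1`) with `SmallField U a`, `0 ≤ a ≤ 1∕4`, `a < ε∕(L^{j+2})²` (interiority (8), assumed),
`LevelSmall d L (j+1) (ε∕(L^{j+2})²)`, the flux form `B` of `U`, and every skew `N·L^{j+2}`-periodic `ψ` tangent to the fibre of the iterated average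
(`TangentIter L j (cavg L U) (cpush L U ψ)`):
  `|Σ_{x ∈ periodBox (N·L^{j+2})} Σ_ν hsR (frame U ψ x ν) (Σ_μ ∇_μ^† B_{μν}(x))| ≤ 12·#Plane(d)·a²·dirL1 ψ (periodBox (N·L^{j+2}))`. [folklore] -/
theorem tension_pairing_le_of_interior_isMinimiser [Nonempty n] {L N : ℕ} (hL : 1 ≤ L) (hN : 1 ≤ N) {ε a : ℝ} (j : ℕ)
    {V U : Site d → Fin d → (Matrix n n ℂ)ˣ} (hmin : IsMinimiser d (sfClass d L N ε) L N (j + 2) V U)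
    (ha0 : 0 ≤ a) (ha : a ≤ 1 / 4) (haε : a < ε / ((L : ℝ) ^ (j + 2)) ^ 2) (hUa : SmallField U a)
    (hls : LevelSmall d L (j + 1) (ε / ((L : ℝ) ^ (j + 2)) ^ 2))
    {B : Site d → Fin d → Fin d → Matrix n n ℂ}
    (hBF : ∀ (x : Site d) (μ ν : Fin d) (h : μ < ν), B x μ ν = flux U (x, ⟨(μ, ν), h⟩))
    (hanti : ∀ (x : Site d) (μ ν : Fin d), B x ν μ = -B x μ ν)
    {ψ : Site d → Fin d → Matrix n n ℂ} (hψs : IsSkewDir ψ) (hψP : IsPeriodicDir ψ ((N * L ^ (j + 2) : ℕ) : ℤ))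
    (hψT : TangentIter L j (cavg L U) (cpush L U ψ)) :
    |∑ x ∈ periodBox (d := d) (N * L ^ (j + 2)), ∑ ν : Fin d,
        hsR (frame U ψ x ν) (∑ μ : Fin d, cDstar U μ (fun y => B y μ ν) x)|
      ≤ 12 * (Fintype.card (T4AveragingDeficitWall.Plane d) : ℝ) * a ^ 2 * dirL1 ψ (periodBox (d := d) (N * L ^ (j + 2))) := by
  have hP : 1 ≤ N * L ^ (j + 2) := Nat.one_le_iff_ne_zero.mpr (Nat.mul_ne_zero (by omega) (pow_ne_zero _ (by omega)))
  have hcrit := critical_of_interior_isMinimiser hL hN j hmin ha0 haε hUa hls hψs hψP hψT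
  exact tension_pairing_le_of_critical hP hmin.mem.1.1 hmin.mem.1.2.1 ha0 ha hUa hψs hψP hBF hanti hcrit

end

end Summit.QuantumFields.BalabanUV.T4Continuum.NE7MinimiserTensionPairing
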